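import Summits.CriticalPhenomena.PercolationContinuityZ3.Theorems.PercNearOneGluingNoHeavyLowerTailE3FourPointSplitGluing
import HarnessLib

/-!
# `NoHeavyLowerTail` (stmt-CriticalPhenomena-4575) — the four-point increasing class `β` is preserved by gluing two weighted graphs along the four terminals

Support file (prover prim-sahi-p2 gen 2, SAHI cell P2; `--supports stmt-CriticalPhenomena-4575`).  No definitions, no named facts, no sorries.
Companion of `…E3FourPointSplitGluing` (class `γ`): the open increasing E3GRP class `β = E₃(U[a|bcy], U[ab|cy], U[acy|b])` (`row4 5` of
`…E3FourPointClassesLeFive`) is Sahi's `E₃` on the complements of the decreasing sunflower `D[a|bcy], D[ab|cy], D[acy|b]` (core: `a` and `b` both isolated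
from the other terminals), whose separations again cover the terminal set `{a,b,c,y}`.  Hence, exactly as for `γ`:
* `FourPointSplit.beta_prodForm` — `β = (1 + k)(1 + d₁ + d₂ + d₃) − Π(1 + d_i)` in the finitary probabilities of the three separations and of the core, with
  `0 ≤ k ≤ d_i`, `Σd ≤ 1 + 2k`;
* `FourPointSplit.sahiE3_fourPointBeta_nonneg_of_terminalGluing` — **`β ≥ 0` is preserved by gluing along the four terminals** (`IncTwin.prodForm_mul_nonneg` +
  `TerminalGluing.PrW_groupSep_union / _inter_union`).
Event convention: `U[a|bcy] = {a↔b} ∪ {a↔c} ∪ {a↔y}`, `U[ab|cy] = {a↔c} ∪ {a↔y} ∪ {b↔c} ∪ {b↔y}`, `U[acy|b] = {a↔b} ∪ {b↔c} ∪ {b↔y}`.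
[cite: LiebSahi2021, eq. (2.1) (the functional E₃)]; [cite: Grimmett1999, §2.2 (independence of disjoint edge sets)]
-/

noncomputable section

namespace Summit.CriticalPhenomena.PercolationContinuityZ3.Theorems

namespace FourPointSplit

open Finset MeasureTheory Literature.Probability.Percolation Literature.Probability.Percolation.DecisionTree
open Literature.Probability.LatticeModels CubicThreePointStep TerminalGluing

variable {V : Type*} [Fintype V] [DecidableEq V]

section OneWeight

variable (w : Sym2 V → unitInterval) (a b c y : V)

omit [Fintype V] [DecidableEq V] in
/-- `a` isolated from `b, c, y` is the complement of `U[a|bcy]`. [folklore] -/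
theorem compl_lnk_a :
    (openConn a b ∪ openConn a c ∪ openConn a y : Set (BondConfig V))ᶜ =
      {ω | ∀ x ∈ ({a} : Set V), ∀ z ∈ ({b, c, y} : Set V), ¬ (openGraph ω).Reachable x z} := by
  ext ω
  simp only [Set.mem_compl_iff, Set.mem_union, openConn, Set.mem_setOf_eq, Set.mem_insert_iff, Set.mem_singleton_iff,
    forall_eq_or_imp, forall_eq]
  tauto

omit [Fintype V] [DecidableEq V] in
/-- `b` isolated from `a, c, y` is the complement of `U[acy|b]`. [folklore] -/
theorem compl_lnk_b :
    (openConn a b ∪ openConn b c ∪ openConn b y : Set (BondConfig V))ᶜ =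
      {ω | ∀ x ∈ ({a, c, y} : Set V), ∀ z ∈ ({b} : Set V), ¬ (openGraph ω).Reachable x z} := by
  ext ω
  simp only [Set.mem_compl_iff, Set.mem_union, openConn, Set.mem_setOf_eq, Set.mem_insert_iff, Set.mem_singleton_iff,
    forall_eq_or_imp, forall_eq]
  constructor
  · intro h
    exact ⟨fun h' => h (Or.inl (Or.inl h')), fun h' => h (Or.inl (Or.inr h'.symm)), fun h' => h (Or.inr h'.symm)⟩
  · rintro ⟨h1, h2, h3⟩ ((h' | h') | h')
    exacts [h1 h', h2 h'.symm, h3 h'.symm]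

omit [Fintype V] [DecidableEq V] in
/-- Sunflower: `D[a|bcy] ∩ D[acy|b] = D[a|bcy] ∩ D[ab|cy]`. [folklore] -/
theorem beta_inter₁₃ :
    (openConn a b ∪ openConn a c ∪ openConn a y : Set (BondConfig V))ᶜ ∩ (openConn a b ∪ openConn b c ∪ openConn b y)ᶜ =
      (openConn a b ∪ openConn a c ∪ openConn a y)ᶜ ∩ (openConn a c ∪ openConn a y ∪ openConn b c ∪ openConn b y)ᶜ := by
  ext ω
  simp only [Set.mem_inter_iff, Set.mem_compl_iff, Set.mem_union, not_or]
  tauto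

omit [Fintype V] [DecidableEq V] in
/-- Sunflower: `D[ab|cy] ∩ D[acy|b] = D[a|bcy] ∩ D[ab|cy]`. [folklore] -/
theorem beta_inter₂₃ :
    (openConn a c ∪ openConn a y ∪ openConn b c ∪ openConn b y : Set (BondConfig V))ᶜ ∩ (openConn a b ∪ openConn b c ∪ openConn b y)ᶜ =
      (openConn a b ∪ openConn a c ∪ openConn a y)ᶜ ∩ (openConn a c ∪ openConn a y ∪ openConn b c ∪ openConn b y)ᶜ := by
  ext ω
  simp only [Set.mem_inter_iff, Set.mem_compl_iff, Set.mem_union, not_or]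
  tauto

/-- **`β` in product coordinates over any finite edge set carrying the weights.**  With `d₁, d₂, d₃` the finitary probabilities of the separations
`D[a|bcy], D[ab|cy], D[acy|b]` and `k` that of the core `D[a|bcy] ∩ D[ab|cy]`:
`E₃(U[a|bcy], U[ab|cy], U[acy|b]) = (1 + k)(1 + d₁ + d₂ + d₃) − (1 + d₁)(1 + d₂)(1 + d₃)`, and `0 ≤ k ≤ d_i`, `d₁ + d₂ + d₃ ≤ 1 + 2k`.
[cite: LiebSahi2021, eq. (2.1) (the functional E₃)] -/
theorem beta_prodForm (D : Finset (Sym2 V)) (hw : ∀ e, e ∉ D → w e = 0) :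
    sahiE3 (prodBernoulli w) (openConn a b ∪ openConn a c ∪ openConn a y)
        (openConn a c ∪ openConn a y ∪ openConn b c ∪ openConn b y) (openConn a b ∪ openConn b c ∪ openConn b y) =
      (1 + PrW D (fun e => (w e : ℝ)) ({S : Finset (Sym2 V) | ∀ x ∈ ({a} : Set V), ∀ z ∈ ({b, c, y} : Set V), ¬ R ∅ S x z} ∩
            {S | ∀ x ∈ ({a, b} : Set V), ∀ z ∈ ({c, y} : Set V), ¬ R ∅ S x z})) *
          (1 + PrW D (fun e => (w e : ℝ)) {S : Finset (Sym2 V) | ∀ x ∈ ({a} : Set V), ∀ z ∈ ({b, c, y} : Set V), ¬ R ∅ S x z}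
            + PrW D (fun e => (w e : ℝ)) {S : Finset (Sym2 V) | ∀ x ∈ ({a, b} : Set V), ∀ z ∈ ({c, y} : Set V), ¬ R ∅ S x z}
            + PrW D (fun e => (w e : ℝ)) {S : Finset (Sym2 V) | ∀ x ∈ ({a, c, y} : Set V), ∀ z ∈ ({b} : Set V), ¬ R ∅ S x z}) -
        (1 + PrW D (fun e => (w e : ℝ)) {S : Finset (Sym2 V) | ∀ x ∈ ({a} : Set V), ∀ z ∈ ({b, c, y} : Set V), ¬ R ∅ S x z}) *
          (1 + PrW D (fun e => (w e : ℝ)) {S : Finset (Sym2 V) | ∀ x ∈ ({a, b} : Set V), ∀ z ∈ ({c, y} : Set V), ¬ R ∅ S x z}) *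
          (1 + PrW D (fun e => (w e : ℝ)) {S : Finset (Sym2 V) | ∀ x ∈ ({a, c, y} : Set V), ∀ z ∈ ({b} : Set V), ¬ R ∅ S x z}) ∧
      PrW D (fun e => (w e : ℝ)) ({S : Finset (Sym2 V) | ∀ x ∈ ({a} : Set V), ∀ z ∈ ({b, c, y} : Set V), ¬ R ∅ S x z} ∩
            {S | ∀ x ∈ ({a, b} : Set V), ∀ z ∈ ({c, y} : Set V), ¬ R ∅ S x z}) ≤
        PrW D (fun e => (w e : ℝ)) {S : Finset (Sym2 V) | ∀ x ∈ ({a} : Set V), ∀ z ∈ ({b, c, y} : Set V), ¬ R ∅ S x z} ∧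
      PrW D (fun e => (w e : ℝ)) ({S : Finset (Sym2 V) | ∀ x ∈ ({a} : Set V), ∀ z ∈ ({b, c, y} : Set V), ¬ R ∅ S x z} ∩
            {S | ∀ x ∈ ({a, b} : Set V), ∀ z ∈ ({c, y} : Set V), ¬ R ∅ S x z}) ≤
        PrW D (fun e => (w e : ℝ)) {S : Finset (Sym2 V) | ∀ x ∈ ({a, b} : Set V), ∀ z ∈ ({c, y} : Set V), ¬ R ∅ S x z} ∧
      PrW D (fun e => (w e : ℝ)) ({S : Finset (Sym2 V) | ∀ x ∈ ({a} : Set V), ∀ z ∈ ({b, c, y} : Set V), ¬ R ∅ S x z} ∩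
            {S | ∀ x ∈ ({a, b} : Set V), ∀ z ∈ ({c, y} : Set V), ¬ R ∅ S x z}) ≤
        PrW D (fun e => (w e : ℝ)) {S : Finset (Sym2 V) | ∀ x ∈ ({a, c, y} : Set V), ∀ z ∈ ({b} : Set V), ¬ R ∅ S x z} ∧
      PrW D (fun e => (w e : ℝ)) {S : Finset (Sym2 V) | ∀ x ∈ ({a} : Set V), ∀ z ∈ ({b, c, y} : Set V), ¬ R ∅ S x z}
          + PrW D (fun e => (w e : ℝ)) {S : Finset (Sym2 V) | ∀ x ∈ ({a, b} : Set V), ∀ z ∈ ({c, y} : Set V), ¬ R ∅ S x z}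
          + PrW D (fun e => (w e : ℝ)) {S : Finset (Sym2 V) | ∀ x ∈ ({a, c, y} : Set V), ∀ z ∈ ({b} : Set V), ¬ R ∅ S x z} ≤
        1 + 2 * PrW D (fun e => (w e : ℝ)) ({S : Finset (Sym2 V) | ∀ x ∈ ({a} : Set V), ∀ z ∈ ({b, c, y} : Set V), ¬ R ∅ S x z} ∩
            {S | ∀ x ∈ ({a, b} : Set V), ∀ z ∈ ({c, y} : Set V), ¬ R ∅ S x z}) := by
  classical
  set μ := prodBernoulli w with hμ
  set L₁ : Set (BondConfig V) := openConn a b ∪ openConn a c ∪ openConn a y with hL₁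
  set L₂ : Set (BondConfig V) := openConn a c ∪ openConn a y ∪ openConn b c ∪ openConn b y with hL₂
  set L₃ : Set (BondConfig V) := openConn a b ∪ openConn b c ∪ openConn b y with hL₃
  have m₁ : MeasurableSet L₁ᶜ := MeasurableSet.of_discrete
  have m₂ : MeasurableSet L₂ᶜ := MeasurableSet.of_discrete
  have m₃ : MeasurableSet L₃ᶜ := MeasurableSet.of_discrete
  have h12 : L₁ᶜ ∩ L₂ᶜ = L₁ᶜ ∩ L₂ᶜ := rfl
  have h13 : L₁ᶜ ∩ L₃ᶜ = L₁ᶜ ∩ L₂ᶜ := by rw [hL₁, hL₂, hL₃]; exact beta_inter₁₃ a b c y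
  have h23 : L₂ᶜ ∩ L₃ᶜ = L₁ᶜ ∩ L₂ᶜ := by rw [hL₁, hL₂, hL₃]; exact beta_inter₂₃ a b c y
  -- Sahi's E₃ on the complements of the sunflower L₁ᶜ, L₂ᶜ, L₃ᶜ (with L_i = L_iᶜᶜ)
  have hE : sahiE3 μ L₁ L₂ L₃ = (1 + μ.real (L₁ᶜ ∩ L₂ᶜ)) * (1 + μ.real L₁ᶜ + μ.real L₂ᶜ + μ.real L₃ᶜ) -
      (1 + μ.real L₁ᶜ) * (1 + μ.real L₂ᶜ) * (1 + μ.real L₃ᶜ) := by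
    have h := ComplSunflower.sahiE3_compl_sunflower_eq_prod μ m₁ m₂ m₃ h12 h13 h23
    simp only [compl_compl] at h
    exact h
  -- the four measures as finitary probabilities
  have e₁ : μ.real L₁ᶜ = PrW D (fun e => (w e : ℝ)) {S : Finset (Sym2 V) | ∀ x ∈ ({a} : Set V), ∀ z ∈ ({b, c, y} : Set V), ¬ R ∅ S x z} := by
    rw [hL₁, compl_lnk_a]; exact real_groupSep w _ _ D hw
  have e₂ : μ.real L₂ᶜ = PrW D (fun e => (w e : ℝ)) {S : Finset (Sym2 V) | ∀ x ∈ ({a, b} : Set V), ∀ z ∈ ({c, y} : Set V), ¬ R ∅ S x z} := by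
    rw [hL₂, compl_lnk₁]; exact real_groupSep w _ _ D hw
  have e₃ : μ.real L₃ᶜ = PrW D (fun e => (w e : ℝ)) {S : Finset (Sym2 V) | ∀ x ∈ ({a, c, y} : Set V), ∀ z ∈ ({b} : Set V), ¬ R ∅ S x z} := by
    rw [hL₃, compl_lnk_b]; exact real_groupSep w _ _ D hw
  have eK : μ.real (L₁ᶜ ∩ L₂ᶜ) = PrW D (fun e => (w e : ℝ)) ({S : Finset (Sym2 V) | ∀ x ∈ ({a} : Set V), ∀ z ∈ ({b, c, y} : Set V), ¬ R ∅ S x z} ∩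
      {S | ∀ x ∈ ({a, b} : Set V), ∀ z ∈ ({c, y} : Set V), ¬ R ∅ S x z}) := by
    rw [hL₁, hL₂, compl_lnk_a, compl_lnk₁]; exact real_groupSep_inter w _ _ _ _ D hw
  -- order facts at measure level
  have hK₁ : μ.real (L₁ᶜ ∩ L₂ᶜ) ≤ μ.real L₁ᶜ := measureReal_mono Set.inter_subset_left
  have hK₂ : μ.real (L₁ᶜ ∩ L₂ᶜ) ≤ μ.real L₂ᶜ := measureReal_mono Set.inter_subset_right
  have hK₃ : μ.real (L₁ᶜ ∩ L₂ᶜ) ≤ μ.real L₃ᶜ := by rw [← h13]; exact measureReal_mono Set.inter_subset_right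
  have hSum : μ.real L₁ᶜ + μ.real L₂ᶜ + μ.real L₃ᶜ ≤ 1 + 2 * μ.real (L₁ᶜ ∩ L₂ᶜ) := by
    have hu := measureReal_union₃_of_pairwise_inter_eq μ m₂ m₃ h12 h13 h23
    have h1 : μ.real (L₁ᶜ ∪ L₂ᶜ ∪ L₃ᶜ) ≤ 1 := measureReal_le_one
    linarith
  refine ⟨?_, ?_, ?_, ?_, ?_⟩
  · rw [← e₁, ← e₂, ← e₃, ← eK]; exact hE
  · rw [← e₁, ← eK]; exact hK₁
  · rw [← e₂, ← eK]; exact hK₂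
  · rw [← e₃, ← eK]; exact hK₃
  · rw [← e₁, ← e₂, ← e₃, ← eK]; exact hSum

end OneWeight

/-- **Gluing along the four terminals preserves `β ≥ 0`.**  Let `w` be supported on `D₁ ∪ D₂` with `D₁, D₂` disjoint edge sets whose edges share only the
terminals `a, b, c, y`.  If both restrictions `w·1_{D₁}`, `w·1_{D₂}` satisfy `0 ≤ E₃(U[a|bcy], U[ab|cy], U[acy|b])` (the increasing E3GRP class `β`), then so
does `w`. [cite: LiebSahi2021, eq. (2.1) (the functional E₃)] -/
theorem sahiE3_fourPointBeta_nonneg_of_terminalGluing (w : Sym2 V → unitInterval) {D₁ D₂ : Finset (Sym2 V)} {a b c y : V}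
    (hD : Disjoint D₁ D₂) (hsep : ∀ v : V, ∀ e₁ ∈ D₁, ∀ e₂ ∈ D₂, v ∈ e₁ → v ∈ e₂ → (v = a ∨ v = b ∨ v = c ∨ v = y))
    (hw : ∀ e, e ∉ D₁ ∪ D₂ → w e = 0)
    (h₁ : 0 ≤ sahiE3 (prodBernoulli fun e => if e ∈ D₁ then w e else 0) (openConn a b ∪ openConn a c ∪ openConn a y)
        (openConn a c ∪ openConn a y ∪ openConn b c ∪ openConn b y) (openConn a b ∪ openConn b c ∪ openConn b y))
    (h₂ : 0 ≤ sahiE3 (prodBernoulli fun e => if e ∈ D₂ then w e else 0) (openConn a b ∪ openConn a c ∪ openConn a y)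
        (openConn a c ∪ openConn a y ∪ openConn b c ∪ openConn b y) (openConn a b ∪ openConn b c ∪ openConn b y)) :
    0 ≤ sahiE3 (prodBernoulli w) (openConn a b ∪ openConn a c ∪ openConn a y)
        (openConn a c ∪ openConn a y ∪ openConn b c ∪ openConn b y) (openConn a b ∪ openConn b c ∪ openConn b y) := by
  classical
  have hw₁ : ∀ e, e ∉ D₁ → (fun e => if e ∈ D₁ then w e else 0) e = 0 := fun e he => by simp [he]
  have hw₂ : ∀ e, e ∉ D₂ → (fun e => if e ∈ D₂ then w e else 0) e = 0 := fun e he => by simp [he]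
  obtain ⟨g₀, -, -, -, -⟩ := beta_prodForm w a b c y (D₁ ∪ D₂) hw
  obtain ⟨g₁, k₁₁, k₁₂, k₁₃, s₁⟩ := beta_prodForm (fun e => if e ∈ D₁ then w e else 0) a b c y D₁ hw₁
  obtain ⟨g₂, k₂₁, k₂₂, k₂₃, s₂⟩ := beta_prodForm (fun e => if e ∈ D₂ then w e else 0) a b c y D₂ hw₂
  rw [g₁] at h₁
  rw [g₂] at h₂
  rw [g₀]
  -- `PrW D_j` only sees the weights on `D_j`
  have congr : ∀ (D : Finset (Sym2 V)) (p p' : Sym2 V → ℝ), (∀ e ∈ D, p e = p' e) → ∀ X, PrW D p X = PrW D p' X := by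
    intro D p p' h X
    unfold PrW
    refine Finset.sum_congr rfl fun S _ => ?_
    have hwt : wtW D p S = wtW D p' S := Finset.prod_congr rfl fun i hi => by rw [h i hi]
    simp only [Set.indicator, hwt]
  have c₁ : ∀ X, PrW D₁ (fun e => (((fun e => if e ∈ D₁ then w e else 0) e : unitInterval) : ℝ)) X = PrW D₁ (fun e => ((w e : unitInterval) : ℝ)) X :=
    congr D₁ _ _ (fun e he => by simp [he])
  have c₂ : ∀ X, PrW D₂ (fun e => (((fun e => if e ∈ D₂ then w e else 0) e : unitInterval) : ℝ)) X = PrW D₂ (fun e => ((w e : unitInterval) : ℝ)) X :=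
    congr D₂ _ _ (fun e he => by simp [he])
  simp only [c₁] at h₁ k₁₁ k₁₂ k₁₃ s₁
  simp only [c₂] at h₂ k₂₁ k₂₂ k₂₃ s₂
  -- factorisation over the pieces
  have hs₁ : ∀ v : V, ∀ e₁ ∈ D₁ ∪ ∅, ∀ e₂ ∈ D₂ ∪ ∅, v ∈ e₁ → v ∈ e₂ → v ∈ (({a} : Set V) ∪ ({b, c, y} : Set V)) := by
    intro v e₁ he₁ e₂ he₂ hv₁ hv₂
    rw [Finset.union_empty] at he₁ he₂
    rcases hsep v e₁ he₁ e₂ he₂ hv₁ hv₂ with h | h | h | h <;> subst h <;> simp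
  have hs₂ : ∀ v : V, ∀ e₁ ∈ D₁ ∪ ∅, ∀ e₂ ∈ D₂ ∪ ∅, v ∈ e₁ → v ∈ e₂ → v ∈ (({a, b} : Set V) ∪ ({c, y} : Set V)) := by
    intro v e₁ he₁ e₂ he₂ hv₁ hv₂
    rw [Finset.union_empty] at he₁ he₂
    rcases hsep v e₁ he₁ e₂ he₂ hv₁ hv₂ with h | h | h | h <;> subst h <;> simp
  have hs₃ : ∀ v : V, ∀ e₁ ∈ D₁ ∪ ∅, ∀ e₂ ∈ D₂ ∪ ∅, v ∈ e₁ → v ∈ e₂ → v ∈ (({a, c, y} : Set V) ∪ ({b} : Set V)) := by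
    intro v e₁ he₁ e₂ he₂ hv₁ hv₂
    rw [Finset.union_empty] at he₁ he₂
    rcases hsep v e₁ he₁ e₂ he₂ hv₁ hv₂ with h | h | h | h <;> subst h <;> simp
  have f₁ := PrW_groupSep_union (K₁ := ∅) (K₂ := ∅) (fun e => ((w e : unitInterval) : ℝ)) hD hs₁
  have f₂ := PrW_groupSep_union (K₁ := ∅) (K₂ := ∅) (fun e => ((w e : unitInterval) : ℝ)) hD hs₂
  have f₃ := PrW_groupSep_union (K₁ := ∅) (K₂ := ∅) (fun e => ((w e : unitInterval) : ℝ)) hD hs₃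
  have fK := PrW_groupSep_inter_union (K₁ := ∅) (K₂ := ∅) (fun e => ((w e : unitInterval) : ℝ)) hD hs₁ hs₂
  simp only [Finset.empty_union] at f₁ f₂ f₃ fK
  rw [fK, f₁, f₂, f₃]
  have hp0 : ∀ e, 0 ≤ (fun e => ((w e : unitInterval) : ℝ)) e := fun e => unitInterval.nonneg (w e)
  have hp1 : ∀ e, (fun e => ((w e : unitInterval) : ℝ)) e ≤ 1 := fun e => unitInterval.le_one (w e)
  exact IncTwin.prodForm_mul_nonneg (PrW_nonneg D₁ hp0 hp1 _) k₁₁ k₁₂ k₁₃ s₁ (PrW_nonneg D₂ hp0 hp1 _) k₂₁ k₂₂ k₂₃ s₂ h₁ h₂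

end FourPointSplit

end Summit.CriticalPhenomena.PercolationContinuityZ3.Theorems
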